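/-
Copyright (c) 2026 the pub-hodgecm-mathlib formalisation cell (harness21).  Prover seat hodgecm-mathlib-K2E3-p03 (g4), Track B «K2-LIT» ∕ h413
(`stmt-HodgeConjecture-24833`), line `K2_E3_EllipticInputs`, unit U12, road «GL-[M6]-sc» (line lead K2E3-p23 (g5), deal (M11-2); census K2E3-p17 (g6)),
brick B4-1m, FILE 2 OF 3: THE PUSH-FORWARD `(μ|_D).map mk` OF A HAAR MEASURE OF `GL₃(F)` RESTRICTED TO THE FUNDAMENTAL DOMAIN `D` IS A HAAR MEASURE OF
`G' = GL₃(F) ⧸ ϖ^ℤ·1`, AND THE A.E.-TRANSFER `GL₃(F) → G'`.  2026-09-04.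
-/
import Summits.HodgeConjecture.HodgeConjecture.Theorems.K2E3GL3ModUniformizerFundamentalDomain   -- ★ B4-1m file 1 (this seat): height, `D`, representatives, `D ≃ₜ G'`, `isCompact_inter_preimage_mk`
import Mathlib.MeasureTheory.Measure.Haar.Unique
import HarnessLib

/-!
# K2_E3 road (h413), road «GL-[M6]-sc», brick B4-1m (file 2 of 3) — `(μ|_D).map mk` is a Haar measure of `G'`; a.e.-transfer from `GL₃(F)` to `G'`

Cell `pub/hodgecm-mathlib` (D-0151), Track B (21-frontier RULING «PUSH BOTH» 2026-09-03, director req624), seat K2E3-p03 (g4); by-name deal (M11-2) of the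
line lead K2E3-p23 (g5), squad bus 2026-09-04T06:52:23Z, census K2E3-p17 (g6) 06:47:03Z (iv).  `--supports stmt-HodgeConjecture-24833 --as helper`;
THEOREMS ONLY (no definition ∕ instance ∕ notation ∕ named fact ∕ `sorry`); never imports `Cruxes/…/Lines`.  COUNT-NEUTRAL.

`G' := GL (Fin 3) F ⧸ N'`, `N' := (Subgroup.zpowers (Units.mk0 ϖ hϖ0)).map (Matrix.GeneralLinearGroup.scalar (Fin 3))`, height `h g := log v(det g) ∈ ℤ`,
window `D := {g | h g ∈ [−2, 0]}` (★ file 1), `μ` a left-invariant (resp. Haar) measure on `GL₃(F)`, `μ₁ := (μ.restrict D).map mk` (all spelled out; binder-style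
`[MeasurableSpace] [BorelSpace]` on `GL₃(F)` and on `G'`).

THE RESULTS.
* `map_mk_restrict_apply` — `μ₁(A) = μ(D ∩ mk⁻¹ A)` for measurable `A`;
* `measure_inter_setOf_log_eq_add` — for `ϖ^ℤ`-saturated `T`: `μ(T ∩ {h = i + 3k}) = μ(T ∩ {h = i})` (left-invariance under `ϖ^k·1`, ★ file 1
  `preimage_scalar_zpow_mul_setOf_log_eq`); `measure_inter_setOf_log_mem_Icc` — `μ(T ∩ {h ∈ [j−2, j]}) = Σ_{i = j−2}^{j} μ(T ∩ {h = i})`;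
  `sum_three_periodic` — a 3-periodic `f : ℤ → ℝ≥0∞` has `f(j−2) + f(j−1) + f(j) = f(−2) + f(−1) + f(0)`;
* **`isMulLeftInvariant_map_mk_restrict`** — `μ₁` is LEFT-INVARIANT: for `y = mk x`, `μ₁(y⁻¹A) = μ(x⁻¹T ∩ D) = μ(T ∩ xD)` with `T = mk⁻¹A` saturated and
  `xD = {h ∈ [h x − 2, h x]}`; both `D` and `xD` are unions of three level sets over a complete residue system mod 3, and `i ↦ μ(T ∩ {h = i})` is 3-periodic
  (NO fundamental-domain machinery, NO finite covolume);
* **`isHaarMeasure_map_mk_restrict`** — for `μ` Haar, `μ₁` is a HAAR MEASURE of `G'` (finite on compacts by ★ file 1 `isCompact_inter_preimage_mk`, positive on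
  opens since `D` is open and `mk|_D` is onto);
* **`measure_eq_zero_of_measure_preimage_mk_eq_zero`**, **`ae_of_ae_comp_mk`** — THE A.E.-TRANSFER: for EVERY Haar measure `μ'` of `G'` and measurable `A`
  (resp. `P` with measurable `{P}`): `μ(mk⁻¹ A) = 0 ⇒ μ'(A) = 0`, `(∀ᵐ g ∂μ, P (mk g)) ⇒ ∀ᵐ x ∂μ', P x` (Haar uniqueness: Mathlib `absolutelyContinuous_isHaarMeasure`).
File 3 (`…SeparableAE`): a.e. `x ∈ G'` has a lift with separable characteristic polynomial.
[WeilIntegration1965, §7–§8 (quotient measures); Cartier1979, §I.3–I.4; HarishChandra1970, Part VII §3 p. 70]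
HONEST LABEL: HC_CM is proved only modulo the 7 printed citations (2 remaining named inputs: hLiu418 = stmt-HodgeConjecture-24832, h413 =
stmt-HodgeConjecture-24833) until rung 0 closes; count-neutral helper.

## References
* [WeilIntegration1965] A. Weil, *L'intégration dans les groupes topologiques et ses applications*, 2e éd. (1965), §7–§8.
* [Cartier1979] P. Cartier, *Representations of p-adic groups: a survey*, Corvallis (1979), §I.3–I.4.
* [HarishChandra1970] Harish-Chandra (notes by G. van Dijk), *Harmonic Analysis on Reductive p-adic Groups*, LNM 162 (1970), Part VII §3.
-/

set_option autoImplicit false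
set_option linter.dupNamespace false   -- `Summit.HodgeConjecture.HodgeConjecture.…` (D-0017 nested layout; lakefile exemption for Summits)

noncomputable section

open MeasureTheory Measure Topology
open scoped Matrix MatrixGroups WithZero ENNReal
open Summit.HodgeConjecture.HodgeConjecture.Cruxes.H413.K2E3GL3ModCentre
open Summit.HodgeConjecture.HodgeConjecture.Cruxes.H413.K2E3GL3ModCocompactCentral
open Summit.HodgeConjecture.HodgeConjecture.Cruxes.H413.K2E3GL3ModUniformizerCocompact
open Summit.HodgeConjecture.HodgeConjecture.Cruxes.H413.K2E3GL3ModUniformizerFundamentalDomain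

namespace Summit.HodgeConjecture.HodgeConjecture.Cruxes.H413.K2E3GL3ModUniformizerHaarTransfer

variable {F : Type*} [Field F] [Valued F ℤᵐ⁰] [ValuativeRel F] [(Valued.v : Valuation F ℤᵐ⁰).Compatible] [IsNonarchimedeanLocalField F]
  [MeasurableSpace (GL (Fin 3) F)] [BorelSpace (GL (Fin 3) F)]
  {ϖ : F} (hϖ : Valued.v ϖ = WithZero.exp (-1 : ℤ)) (hϖ0 : ϖ ≠ 0) (μ : Measure (GL (Fin 3) F))

/-! ## §1  Level sets and windows of the height under a left-invariant measure on `GL₃(F)` -/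

section Upstairs

include hϖ in
/-- Level sets of the height are measurable (they are clopen, ★ file 1). [folklore] -/
theorem measurableSet_setOf_log_eq (i : ℤ) : MeasurableSet {g : GL (Fin 3) F | WithZero.log (Valued.v (g : Matrix (Fin 3) (Fin 3) F).det) = i} := by
  have h : {g : GL (Fin 3) F | WithZero.log (Valued.v (g : Matrix (Fin 3) (Fin 3) F).det) = i} =
      {g : GL (Fin 3) F | WithZero.log (Valued.v (g : Matrix (Fin 3) (Fin 3) F).det) ∈ ({i} : Set ℤ)} := by
    ext g; simp only [Set.mem_setOf_eq, Set.mem_singleton_iff]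
  rw [h]
  exact (isClopen_preimage_log_v_det hϖ {i}).isOpen.measurableSet

omit [(Valued.v : Valuation F ℤᵐ⁰).Compatible] in
include hϖ in
/-- **3-periodicity**: for a `ϖ^ℤ`-saturated `T`, `μ(T ∩ {h = i + 3k}) = μ(T ∩ {h = i})` (left-invariance of `μ` under `ϖ^k·1`). [cite: WeilIntegration1965, §7] -/
theorem measure_inter_setOf_log_eq_add [μ.IsMulLeftInvariant] {T : Set (GL (Fin 3) F)}
    (hT : ∀ k : ℤ, (fun g : GL (Fin 3) F => Matrix.GeneralLinearGroup.scalar (Fin 3) (Units.mk0 ϖ hϖ0 ^ k) * g) ⁻¹' T = T) (i k : ℤ) :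
    μ (T ∩ {g : GL (Fin 3) F | WithZero.log (Valued.v (g : Matrix (Fin 3) (Fin 3) F).det) = i + 3 * k}) =
      μ (T ∩ {g : GL (Fin 3) F | WithZero.log (Valued.v (g : Matrix (Fin 3) (Fin 3) F).det) = i}) := by
  rw [← measure_preimage_mul μ (Matrix.GeneralLinearGroup.scalar (Fin 3) (Units.mk0 ϖ hϖ0 ^ k))
    (T ∩ {g : GL (Fin 3) F | WithZero.log (Valued.v (g : Matrix (Fin 3) (Fin 3) F).det) = i}), Set.preimage_inter, hT k,
    preimage_scalar_zpow_mul_setOf_log_eq hϖ hϖ0]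

omit [ValuativeRel F] [(Valued.v : Valuation F ℤᵐ⁰).Compatible] [IsNonarchimedeanLocalField F] [BorelSpace (GL (Fin 3) F)] in
/-- The window `{h ∈ [j−2, j]}` is the disjoint union of the three level sets `{h = j−2}, {h = j−1}, {h = j}`:
`μ(T ∩ {h ∈ [j−2, j]}) = μ(T ∩ {h = j−2}) + μ(T ∩ {h = j−1}) + μ(T ∩ {h = j})`. [folklore] -/
theorem measure_inter_setOf_log_mem_Icc (hmeas : ∀ i : ℤ, MeasurableSet {g : GL (Fin 3) F | WithZero.log (Valued.v (g : Matrix (Fin 3) (Fin 3) F).det) = i})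
    (T : Set (GL (Fin 3) F)) (hTm : MeasurableSet T) (j : ℤ) :
    μ (T ∩ {g : GL (Fin 3) F | WithZero.log (Valued.v (g : Matrix (Fin 3) (Fin 3) F).det) ∈ Set.Icc (j - 2) j}) =
      μ (T ∩ {g : GL (Fin 3) F | WithZero.log (Valued.v (g : Matrix (Fin 3) (Fin 3) F).det) = j - 2}) +
        μ (T ∩ {g : GL (Fin 3) F | WithZero.log (Valued.v (g : Matrix (Fin 3) (Fin 3) F).det) = j - 1}) +
          μ (T ∩ {g : GL (Fin 3) F | WithZero.log (Valued.v (g : Matrix (Fin 3) (Fin 3) F).det) = j}) := by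
  have hset : T ∩ {g : GL (Fin 3) F | WithZero.log (Valued.v (g : Matrix (Fin 3) (Fin 3) F).det) ∈ Set.Icc (j - 2) j} =
      (T ∩ {g : GL (Fin 3) F | WithZero.log (Valued.v (g : Matrix (Fin 3) (Fin 3) F).det) = j - 2} ∪
        T ∩ {g : GL (Fin 3) F | WithZero.log (Valued.v (g : Matrix (Fin 3) (Fin 3) F).det) = j - 1}) ∪
          T ∩ {g : GL (Fin 3) F | WithZero.log (Valued.v (g : Matrix (Fin 3) (Fin 3) F).det) = j} := by
    ext g
    simp only [Set.mem_inter_iff, Set.mem_setOf_eq, Set.mem_Icc, Set.mem_union]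
    by_cases hg : g ∈ T
    · simp only [hg, true_and]
      omega
    · simp only [hg, false_and, false_or]
  have hd1 : Disjoint (T ∩ {g : GL (Fin 3) F | WithZero.log (Valued.v (g : Matrix (Fin 3) (Fin 3) F).det) = j - 2} ∪
      T ∩ {g : GL (Fin 3) F | WithZero.log (Valued.v (g : Matrix (Fin 3) (Fin 3) F).det) = j - 1})
      (T ∩ {g : GL (Fin 3) F | WithZero.log (Valued.v (g : Matrix (Fin 3) (Fin 3) F).det) = j}) := by
    refine Set.disjoint_left.2 fun g hg hg' => ?_
    simp only [Set.mem_inter_iff, Set.mem_setOf_eq, Set.mem_union] at hg hg'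
    omega
  have hd2 : Disjoint (T ∩ {g : GL (Fin 3) F | WithZero.log (Valued.v (g : Matrix (Fin 3) (Fin 3) F).det) = j - 2})
      (T ∩ {g : GL (Fin 3) F | WithZero.log (Valued.v (g : Matrix (Fin 3) (Fin 3) F).det) = j - 1}) := by
    refine Set.disjoint_left.2 fun g hg hg' => ?_
    simp only [Set.mem_inter_iff, Set.mem_setOf_eq] at hg hg'
    omega
  rw [hset, measure_union hd1 (hTm.inter (hmeas j)), measure_union hd2 (hTm.inter (hmeas (j - 1)))]

omit [ValuativeRel F] [(Valued.v : Valuation F ℤᵐ⁰).Compatible] [IsNonarchimedeanLocalField F] in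
/-- A 3-periodic `f : ℤ → ℝ≥0∞` has the same sum over any three consecutive integers: `f(j−2) + f(j−1) + f(j) = f(−2) + f(−1) + f(0)`. [folklore] -/
theorem sum_three_periodic {f : ℤ → ℝ≥0∞} (hf : ∀ i k : ℤ, f (i + 3 * k) = f i) (j : ℤ) :
    f (j - 2) + f (j - 1) + f j = f (-2) + f (-1) + f 0 := by
  have hr : j % 3 = 0 ∨ j % 3 = 1 ∨ j % 3 = 2 := by omega
  rcases hr with h | h | h
  · have e1 : j - 2 = -2 + 3 * (j / 3) := by omega
    have e2 : j - 1 = -1 + 3 * (j / 3) := by omega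
    have e3 : j = 0 + 3 * (j / 3) := by omega
    rw [e1, e2, hf, hf]
    conv_lhs => rw [e3, hf]
  · have e1 : j - 2 = -1 + 3 * (j / 3) := by omega
    have e2 : j - 1 = 0 + 3 * (j / 3) := by omega
    have e3 : j = -2 + 3 * (j / 3 + 1) := by omega
    rw [e1, e2, hf, hf]
    conv_lhs => rw [e3, hf]
    ac_rfl
  · have e1 : j - 2 = 0 + 3 * (j / 3) := by omega
    have e2 : j - 1 = -2 + 3 * (j / 3 + 1) := by omega
    have e3 : j = -1 + 3 * (j / 3 + 1) := by omega
    rw [e1, e2, hf, hf]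
    conv_lhs => rw [e3, hf]
    ac_rfl

end Upstairs

/-! ## §2  `μ₁ = (μ|_D).map mk` is left-invariant, hence a Haar measure of `G'` -/

section Downstairs

variable [((Subgroup.zpowers (Units.mk0 ϖ hϖ0)).map (Matrix.GeneralLinearGroup.scalar (Fin 3))).Normal]
  [MeasurableSpace (GL (Fin 3) F ⧸ (Subgroup.zpowers (Units.mk0 ϖ hϖ0)).map (Matrix.GeneralLinearGroup.scalar (Fin 3)))]
  [BorelSpace (GL (Fin 3) F ⧸ (Subgroup.zpowers (Units.mk0 ϖ hϖ0)).map (Matrix.GeneralLinearGroup.scalar (Fin 3)))]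

omit [ValuativeRel F] [(Valued.v : Valuation F ℤᵐ⁰).Compatible] [IsNonarchimedeanLocalField F]
  [((Subgroup.zpowers (Units.mk0 ϖ hϖ0)).map (Matrix.GeneralLinearGroup.scalar (Fin 3))).Normal] in
/-- `μ₁(A) = μ(mk⁻¹ A ∩ D)` for measurable `A ⊆ G'`. [cite: WeilIntegration1965, §7] -/
theorem map_mk_restrict_apply {A : Set (GL (Fin 3) F ⧸ (Subgroup.zpowers (Units.mk0 ϖ hϖ0)).map (Matrix.GeneralLinearGroup.scalar (Fin 3)))}
    (hA : MeasurableSet A) :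
    ((μ.restrict {g : GL (Fin 3) F | WithZero.log (Valued.v (g : Matrix (Fin 3) (Fin 3) F).det) ∈ Set.Icc (-2 : ℤ) 0}).map
        (QuotientGroup.mk : GL (Fin 3) F → GL (Fin 3) F ⧸ (Subgroup.zpowers (Units.mk0 ϖ hϖ0)).map (Matrix.GeneralLinearGroup.scalar (Fin 3)))) A =
      μ ((QuotientGroup.mk : GL (Fin 3) F → GL (Fin 3) F ⧸ (Subgroup.zpowers (Units.mk0 ϖ hϖ0)).map (Matrix.GeneralLinearGroup.scalar (Fin 3))) ⁻¹' A ∩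
        {g : GL (Fin 3) F | WithZero.log (Valued.v (g : Matrix (Fin 3) (Fin 3) F).det) ∈ Set.Icc (-2 : ℤ) 0}) := by
  rw [Measure.map_apply QuotientGroup.continuous_mk.measurable hA, Measure.restrict_apply (QuotientGroup.continuous_mk.measurable hA)]

include hϖ in
/-- **`μ₁ = (μ|_D).map mk` is LEFT-INVARIANT** (the mod-3 re-indexing of level sets; no fundamental-domain machinery).
[cite: WeilIntegration1965, §7–§8; cite: Cartier1979, §I.3] -/
theorem isMulLeftInvariant_map_mk_restrict [μ.IsMulLeftInvariant] :
    (((μ.restrict {g : GL (Fin 3) F | WithZero.log (Valued.v (g : Matrix (Fin 3) (Fin 3) F).det) ∈ Set.Icc (-2 : ℤ) 0}).map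
        (QuotientGroup.mk : GL (Fin 3) F → GL (Fin 3) F ⧸ (Subgroup.zpowers (Units.mk0 ϖ hϖ0)).map (Matrix.GeneralLinearGroup.scalar (Fin 3))))).IsMulLeftInvariant := by
  refine ⟨fun y => ?_⟩
  obtain ⟨x, rfl⟩ := QuotientGroup.mk_surjective y
  refine Measure.ext fun A hA => ?_
  have hA' : MeasurableSet ((fun z : GL (Fin 3) F ⧸ (Subgroup.zpowers (Units.mk0 ϖ hϖ0)).map (Matrix.GeneralLinearGroup.scalar (Fin 3)) =>
      (QuotientGroup.mk x : GL (Fin 3) F ⧸ _) * z) ⁻¹' A) := measurable_const_mul _ hA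
  rw [Measure.map_apply (measurable_const_mul _) hA, map_mk_restrict_apply hϖ0 μ hA', map_mk_restrict_apply hϖ0 μ hA]
  -- `T := mk⁻¹ A` is measurable and `ϖ^ℤ`-saturated
  set T : Set (GL (Fin 3) F) :=
    (QuotientGroup.mk : GL (Fin 3) F → GL (Fin 3) F ⧸ (Subgroup.zpowers (Units.mk0 ϖ hϖ0)).map (Matrix.GeneralLinearGroup.scalar (Fin 3))) ⁻¹' A with hTdef
  have hTm : MeasurableSet T := QuotientGroup.continuous_mk.measurable hA
  have hT : ∀ k : ℤ, (fun g : GL (Fin 3) F => Matrix.GeneralLinearGroup.scalar (Fin 3) (Units.mk0 ϖ hϖ0 ^ k) * g) ⁻¹' T = T := fun k => by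
    ext g
    simp only [hTdef, Set.mem_preimage, mk_scalar_zpow_mul hϖ0]
  -- `mk⁻¹(y⁻¹ A) = x⁻¹ T`
  have hpre : (QuotientGroup.mk : GL (Fin 3) F → GL (Fin 3) F ⧸ (Subgroup.zpowers (Units.mk0 ϖ hϖ0)).map (Matrix.GeneralLinearGroup.scalar (Fin 3))) ⁻¹'
      ((fun z : GL (Fin 3) F ⧸ (Subgroup.zpowers (Units.mk0 ϖ hϖ0)).map (Matrix.GeneralLinearGroup.scalar (Fin 3)) =>
        (QuotientGroup.mk x : GL (Fin 3) F ⧸ _) * z) ⁻¹' A) = (fun g : GL (Fin 3) F => x * g) ⁻¹' T := by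
    ext g
    simp only [hTdef, Set.mem_preimage, QuotientGroup.mk_mul]
  -- `D ∩ x⁻¹ T = x⁻¹ (T ∩ xD)` with `xD = {h ∈ [h x − 2, h x]}`
  have hD : {g : GL (Fin 3) F | WithZero.log (Valued.v (g : Matrix (Fin 3) (Fin 3) F).det) ∈ Set.Icc (-2 : ℤ) 0} =
      (fun g : GL (Fin 3) F => x * g) ⁻¹' {g : GL (Fin 3) F | WithZero.log (Valued.v (g : Matrix (Fin 3) (Fin 3) F).det) ∈
        Set.Icc (WithZero.log (Valued.v (x : Matrix (Fin 3) (Fin 3) F).det) - 2) (WithZero.log (Valued.v (x : Matrix (Fin 3) (Fin 3) F).det))} := by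
    rw [preimage_mul_setOf_log_mem]
    ext g
    simp only [Set.mem_setOf_eq, Set.mem_Icc]
    omega
  have hL : μ ((fun g : GL (Fin 3) F => x * g) ⁻¹' T ∩ {g : GL (Fin 3) F | WithZero.log (Valued.v (g : Matrix (Fin 3) (Fin 3) F).det) ∈ Set.Icc (-2 : ℤ) 0}) =
      μ (T ∩ {g : GL (Fin 3) F | WithZero.log (Valued.v (g : Matrix (Fin 3) (Fin 3) F).det) ∈
        Set.Icc (WithZero.log (Valued.v (x : Matrix (Fin 3) (Fin 3) F).det) - 2) (WithZero.log (Valued.v (x : Matrix (Fin 3) (Fin 3) F).det))}) := by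
    rw [hD, ← Set.preimage_inter, measure_preimage_mul]
  have h0 := measure_inter_setOf_log_mem_Icc μ (measurableSet_setOf_log_eq hϖ) T hTm 0
  simp only [zero_sub] at h0
  rw [hpre, hL, measure_inter_setOf_log_mem_Icc μ (measurableSet_setOf_log_eq hϖ) T hTm (WithZero.log (Valued.v (x : Matrix (Fin 3) (Fin 3) F).det)), h0]
  exact sum_three_periodic (f := fun i => μ (T ∩ {g : GL (Fin 3) F | WithZero.log (Valued.v (g : Matrix (Fin 3) (Fin 3) F).det) = i}))
    (fun i k => measure_inter_setOf_log_eq_add hϖ hϖ0 μ hT i k) _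

include hϖ in
/-- **For `μ` a Haar measure of `GL₃(F)`, `μ₁ = (μ|_D).map mk` is a HAAR MEASURE of `G'`.** [cite: WeilIntegration1965, §7–§8; cite: Cartier1979, §I.3–I.4] -/
theorem isHaarMeasure_map_mk_restrict [μ.IsHaarMeasure] :
    (((μ.restrict {g : GL (Fin 3) F | WithZero.log (Valued.v (g : Matrix (Fin 3) (Fin 3) F).det) ∈ Set.Icc (-2 : ℤ) 0}).map
        (QuotientGroup.mk : GL (Fin 3) F → GL (Fin 3) F ⧸ (Subgroup.zpowers (Units.mk0 ϖ hϖ0)).map (Matrix.GeneralLinearGroup.scalar (Fin 3))))).IsHaarMeasure := by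
  haveI : T2Space (GL (Fin 3) F ⧸ (Subgroup.zpowers (Units.mk0 ϖ hϖ0)).map (Matrix.GeneralLinearGroup.scalar (Fin 3))) :=
    t2Space_quotScalar _ (isClosed_zpowers_uniformizer hϖ hϖ0)
  haveI := isMulLeftInvariant_map_mk_restrict hϖ hϖ0 μ
  haveI : IsFiniteMeasureOnCompacts (((μ.restrict {g : GL (Fin 3) F | WithZero.log (Valued.v (g : Matrix (Fin 3) (Fin 3) F).det) ∈ Set.Icc (-2 : ℤ) 0}).map
      (QuotientGroup.mk : GL (Fin 3) F → GL (Fin 3) F ⧸ (Subgroup.zpowers (Units.mk0 ϖ hϖ0)).map (Matrix.GeneralLinearGroup.scalar (Fin 3))))) := by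
    refine ⟨fun K hK => ?_⟩
    rw [map_mk_restrict_apply hϖ0 μ hK.measurableSet, Set.inter_comm]
    exact (isCompact_inter_preimage_mk hϖ hϖ0 hK).measure_lt_top
  haveI : IsOpenPosMeasure (((μ.restrict {g : GL (Fin 3) F | WithZero.log (Valued.v (g : Matrix (Fin 3) (Fin 3) F).det) ∈ Set.Icc (-2 : ℤ) 0}).map
      (QuotientGroup.mk : GL (Fin 3) F → GL (Fin 3) F ⧸ (Subgroup.zpowers (Units.mk0 ϖ hϖ0)).map (Matrix.GeneralLinearGroup.scalar (Fin 3))))) := by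
    refine ⟨fun U hU hne => ?_⟩
    rw [map_mk_restrict_apply hϖ0 μ hU.measurableSet]
    obtain ⟨y, hy⟩ := hne
    obtain ⟨g, hg, rfl⟩ := exists_mk_eq_of_log_mem_Icc hϖ hϖ0 y
    exact (((hU.preimage QuotientGroup.continuous_mk).inter (isClopen_preimage_log_v_det hϖ (Set.Icc (-2 : ℤ) 0)).isOpen).measure_pos μ ⟨g, hy, hg⟩).ne'
  exact {}

/-! ## §3  The a.e.-transfer `GL₃(F) → G'` for every Haar measure of `G'` -/

include hϖ in
/-- **Null sets transfer**: if `mk⁻¹ A` is `μ`-null for a Haar measure `μ` of `GL₃(F)`, then `A` is null for EVERY Haar measure `μ'` of `G'` (Haar uniqueness: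
`μ' ≪ (μ|_D).map mk`). [cite: WeilIntegration1965, §8; cite: Cartier1979, §I.4] -/
theorem measure_eq_zero_of_measure_preimage_mk_eq_zero [μ.IsHaarMeasure]
    (μ' : Measure (GL (Fin 3) F ⧸ (Subgroup.zpowers (Units.mk0 ϖ hϖ0)).map (Matrix.GeneralLinearGroup.scalar (Fin 3)))) [μ'.IsHaarMeasure]
    {A : Set (GL (Fin 3) F ⧸ (Subgroup.zpowers (Units.mk0 ϖ hϖ0)).map (Matrix.GeneralLinearGroup.scalar (Fin 3)))} (hA : MeasurableSet A)
    (h0 : μ ((QuotientGroup.mk : GL (Fin 3) F → GL (Fin 3) F ⧸ (Subgroup.zpowers (Units.mk0 ϖ hϖ0)).map (Matrix.GeneralLinearGroup.scalar (Fin 3))) ⁻¹' A) = 0) :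
    μ' A = 0 := by
  haveI : SecondCountableTopology (GL (Fin 3) F) := secondCountableTopology_gl3 F
  haveI : LocallyCompactSpace (GL (Fin 3) F) := locallyCompactSpace_gl3 F
  haveI : SigmaCompactSpace (GL (Fin 3) F ⧸ (Subgroup.zpowers (Units.mk0 ϖ hϖ0)).map (Matrix.GeneralLinearGroup.scalar (Fin 3))) :=
    sigmaCompactSpace_of_locallyCompact_secondCountable
  haveI := isHaarMeasure_map_mk_restrict hϖ hϖ0 μ
  have hac := absolutelyContinuous_isHaarMeasure μ'
    ((μ.restrict {g : GL (Fin 3) F | WithZero.log (Valued.v (g : Matrix (Fin 3) (Fin 3) F).det) ∈ Set.Icc (-2 : ℤ) 0}).map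
      (QuotientGroup.mk : GL (Fin 3) F → GL (Fin 3) F ⧸ (Subgroup.zpowers (Units.mk0 ϖ hϖ0)).map (Matrix.GeneralLinearGroup.scalar (Fin 3))))
  refine hac ?_
  rw [map_mk_restrict_apply hϖ0 μ hA]
  exact measure_mono_null Set.inter_subset_left h0

include hϖ in
/-- **THE A.E.-TRANSFER**: for every Haar measure `μ'` of `G'` and every property `P` with measurable `{P}`, `(∀ᵐ g ∂μ, P (mk g)) ⇒ ∀ᵐ x ∂μ', P x`.
[cite: WeilIntegration1965, §8; cite: HarishChandra1970, Part VII §3 p. 70] -/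
theorem ae_of_ae_comp_mk [μ.IsHaarMeasure]
    (μ' : Measure (GL (Fin 3) F ⧸ (Subgroup.zpowers (Units.mk0 ϖ hϖ0)).map (Matrix.GeneralLinearGroup.scalar (Fin 3)))) [μ'.IsHaarMeasure]
    {P : GL (Fin 3) F ⧸ (Subgroup.zpowers (Units.mk0 ϖ hϖ0)).map (Matrix.GeneralLinearGroup.scalar (Fin 3)) → Prop} (hP : MeasurableSet {x | P x})
    (h : ∀ᵐ g ∂μ, P (QuotientGroup.mk g)) : ∀ᵐ x ∂μ', P x := by
  rw [ae_iff] at h ⊢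
  exact measure_eq_zero_of_measure_preimage_mk_eq_zero hϖ hϖ0 μ μ' hP.compl h

end Downstairs

end Summit.HodgeConjecture.HodgeConjecture.Cruxes.H413.K2E3GL3ModUniformizerHaarTransfer
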